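import Literature.Geometry.Lorentzian.CarterCapMonotone
import HarnessLib

/-!
# The near-horizon slope of Carter's coefficient in the superradiant Breitenlohner–Freedman-stable
# regime: `F′ ≤ −(θ₁/2)(Λ′ − 172)(r − r₊) − (r₊ − r₋)(Λ′ − 86)` and the explicit barrier floor it integrates to
(namespace `Literature.Geometry.Lorentzian.Kerr`.)

Continuation of `CarterCapMonotone.lean`. With `F := (r² + a²)²(ω² − V) = K² − ΔΛ′ − (r² + a²)²V₁`
(`Kerr.sq_mul_coeff_eq`; `V = Kerr.sepPotential M a ω m Λ`, `Λ′ = Λ − 2amω`, `K = ω(r² + a²) − am`), in the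
superradiant (`ωσ < 0`) BF-stable (`(1 + θ₁)(2r₊ω)² ≤ Λ′`, `0 < θ₁ ≤ 1`) regime and on the whole
near-horizon range `r₊ < r ≤ r₊(1 + θ₁/8)` — cap AND barrier, no sign condition on `F`:

* `hasDerivAt_sq_mul_coeff` — `F′ = 4ωrK − 2(r − M)Λ′ − [4r(r² + a²)V₁ + P₁/(r² + a²)³]` (`r > 0`);
* `four_mul_radialK_mul_le` — `4ωrK ≤ 2Λ′(r − r₊)(1 − θ₁/4)`: trivially if `Kω ≤ 0`, and from
  `Kω < ω²(r − r₊)(r + r₊)` (superradiance) and the margin otherwise;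
* `sq_mul_coeff_deriv_le` — `F′ ≤ −(θ₁/2)(Λ′ − 172)(r − r₊) − (r₊ − r₋)(Λ′ − 86)` (with
  `2(r − M) = 2(r − r₊) + (r₊ − r₋)`, `P₁ ≥ −344ΔM⁵`, `r − r₊ ≤ θ₁M/4`);
* `sq_mul_coeff_le_of_le` — integrated form: for `r_b ≤ r` in the range (any `Λ′`),
  `F(r) ≤ F(r_b) − (θ₁/4)(Λ′ − 172)((r − r₊)² − (r_b − r₊)²) − (r₊ − r₋)(Λ′ − 86)(r − r_b)`;
* `negCoeff_ge_of_cap_edge` — hence, if `V(r_b) ≥ ω²` (e.g. `r_b` the cap edge), for `r_b ≤ r ≤ r₊(1 + θ₁/8)`: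
  `V(r) − ω² ≥ [(θ₁/4)(Λ′ − 172)((r − r₊)² − (r_b − r₊)²) + (r₊ − r₋)(Λ′ − 86)(r − r_b)]/(r² + a²)²` —
  the barrier coefficient leaves its turning point at least LINEARLY, with an explicit, κ-honest slope
  (`r₊ − r₋ = 4Mr₊κ`): the cap-edge non-degeneracy consumed by the interior-rate estimates of the
  deep-barrier kernel bound (near-extremal Kerr programme).

Pure algebra and one-variable calculus; all proved.

## References
* M. Dafermos, I. Rodnianski, Y. Shlapentokh-Rothman, arXiv:1402.7034 = Ann. of Math. 183 (2016),
  §§5.2.3, 6.2–6.3 (key `DafermosRodnianskiShlapentokhrothman2014`). The assembly is folklore.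
-/

noncomputable section

open Set Filter
open scoped _root_.Topology

namespace Literature.Geometry.Lorentzian

namespace Kerr

section Slope

variable {M a ω Λ : ℝ} {m : ℤ}

set_option maxHeartbeats 400000 in
-- derivative bookkeeping for `F = K² − ΔΛ′ − (r²+a²)²V₁`
/-- **`F′ = 4ωrK − 2(r − M)Λ′ − [(r² + a²)²V₁]′`** for `F(s) = (s² + a²)²(ω² − V(s))`, at every `r > 0`.
[folklore] -/
theorem hasDerivAt_sq_mul_coeff (M a ω : ℝ) (m : ℤ) (Λ : ℝ) {r : ℝ} (hr0 : 0 < r) :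
    HasDerivAt (fun s : ℝ ↦ (s ^ 2 + a ^ 2) ^ 2 * (ω ^ 2 - sepPotential M a ω m Λ s))
      (2 * radialK a ω m r * (ω * (2 * r)) - 2 * (r - M) * (Λ - 2 * a * m * ω) -
        (2 * (r ^ 2 + a ^ 2) * (2 * r) * sepPotential₁ M a r +
          (r ^ 2 + a ^ 2) ^ 2 * (critPoly₁ M a r / (r ^ 2 + a ^ 2) ^ 5))) r := by
  have hA : r ^ 2 + a ^ 2 ≠ 0 := by positivity
  have hsq : HasDerivAt (fun s : ℝ ↦ (s ^ 2 + a ^ 2) ^ 2) (2 * (r ^ 2 + a ^ 2) * (2 * r)) r := by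
    have h1 : HasDerivAt (fun s : ℝ ↦ s ^ 2 + a ^ 2) (2 * r) r := by
      simpa using (hasDerivAt_pow 2 r).add_const (a ^ 2)
    refine (h1.fun_pow 2).congr_deriv ?_
    norm_num
  have hK : HasDerivAt (fun s : ℝ ↦ radialK a ω m s) (ω * (2 * r)) r := by
    have h1 : HasDerivAt (fun s : ℝ ↦ s ^ 2 + a ^ 2) (2 * r) r := by
      simpa using (hasDerivAt_pow 2 r).add_const (a ^ 2)
    have h2 := (h1.const_mul ω).sub_const (a * (m : ℝ))
    refine h2.congr_of_eventuallyEq (Filter.Eventually.of_forall fun s ↦ ?_)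
    simp [radialK]
  have hK2 : HasDerivAt (fun s : ℝ ↦ radialK a ω m s ^ 2) (2 * radialK a ω m r * (ω * (2 * r))) r := by
    refine (hK.fun_pow 2).congr_deriv ?_
    norm_num
  have hΔd : HasDerivAt (fun s : ℝ ↦ delta M a s * (Λ - 2 * a * m * ω)) (2 * (r - M) * (Λ - 2 * a * m * ω)) r :=
    (hasDerivAt_delta M a r).mul_const _
  have hV₁ := hasDerivAt_sepPotential₁ M a (r := r) hA
  have hW₁ : HasDerivAt (fun s : ℝ ↦ (s ^ 2 + a ^ 2) ^ 2 * sepPotential₁ M a s)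
      (2 * (r ^ 2 + a ^ 2) * (2 * r) * sepPotential₁ M a r +
        (r ^ 2 + a ^ 2) ^ 2 * (critPoly₁ M a r / (r ^ 2 + a ^ 2) ^ 5)) r := hsq.mul hV₁
  have hF₂ : HasDerivAt
      (fun s : ℝ ↦ radialK a ω m s ^ 2 - delta M a s * (Λ - 2 * a * m * ω) -
        (s ^ 2 + a ^ 2) ^ 2 * sepPotential₁ M a s)
      (2 * radialK a ω m r * (ω * (2 * r)) - 2 * (r - M) * (Λ - 2 * a * m * ω) -
        (2 * (r ^ 2 + a ^ 2) * (2 * r) * sepPotential₁ M a r +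
          (r ^ 2 + a ^ 2) ^ 2 * (critPoly₁ M a r / (r ^ 2 + a ^ 2) ^ 5))) r :=
    (hK2.sub hΔd).sub hW₁
  have heq : (fun s : ℝ ↦ radialK a ω m s ^ 2 - delta M a s * (Λ - 2 * a * m * ω) -
        (s ^ 2 + a ^ 2) ^ 2 * sepPotential₁ M a s)
      =ᶠ[𝓝 r] (fun s : ℝ ↦ (s ^ 2 + a ^ 2) ^ 2 * (ω ^ 2 - sepPotential M a ω m Λ s)) := by
    filter_upwards [Ioi_mem_nhds hr0] with s hs
    have hsA : s ^ 2 + a ^ 2 ≠ 0 := by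
      have : (0 : ℝ) < s := hs
      positivity
    exact (sq_mul_coeff_eq M a ω m Λ hsA).symm
  exact hF₂.congr_of_eventuallyEq heq.symm

/-- **`4ωrK ≤ 2Λ′(r − r₊)(1 − θ₁/4)`** on `r₊ < r ≤ r₊(1 + θ₁/8)` in the superradiant BF-stable regime
(`0 < θ₁ ≤ 1`, margin, `ωσ < 0`): if `Kω ≤ 0` the left side is `≤ 0`; otherwise
`Kω < ω²(r − r₊)(r + r₊)` and `4r·ω²(r − r₊)(r + r₊) ≤ (r − r₊)Λ′·(1 + θ₁/8)(2 + θ₁/8)/(1 + θ₁)`.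
[folklore] -/
theorem four_mul_radialK_mul_le (ha : |a| < M) {θ₁ : ℝ} (hθ₁ : 0 < θ₁) (hθ₁1 : θ₁ ≤ 1)
    (hmargin : (1 + θ₁) * (2 * rPlus M a * ω) ^ 2 ≤ Λ - 2 * a * m * ω)
    (hωσ : ω * (ω - m * horizonAngularVelocity M a) < 0)
    {r : ℝ} (hr : rPlus M a < r) (hr2 : r ≤ rPlus M a * (1 + θ₁ / 8)) :
    2 * radialK a ω m r * (ω * (2 * r)) ≤ 2 * (Λ - 2 * a * m * ω) * (r - rPlus M a) * (1 - θ₁ / 4) := by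
  have hM : 0 < M := lt_of_le_of_lt (abs_nonneg a) ha
  have haM : |a| ≤ M := ha.le
  set rp := rPlus M a with hrp
  set Λ' := Λ - 2 * a * m * ω with hΛ'
  set σ := ω - m * horizonAngularVelocity M a with hσdef
  have hrp0 : 0 < rp := rPlus_pos hM a
  have hr0 : 0 < r := hrp0.trans hr
  have hΛ'0 : 0 ≤ Λ' := le_trans (by positivity) hmargin
  have hrhs : 0 ≤ 2 * Λ' * (r - rp) * (1 - θ₁ / 4) := by
    have : 0 ≤ r - rp := by linarith
    have : 0 ≤ 1 - θ₁ / 4 := by linarith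
    positivity
  have e : 2 * radialK a ω m r * (ω * (2 * r)) = 4 * r * (radialK a ω m r * ω) := by ring
  rw [e]
  rcases le_or_gt (radialK a ω m r * ω) 0 with hK | hK
  · exact le_trans (mul_nonpos_of_nonneg_of_nonpos (by positivity) hK) hrhs
  · -- `Kω < ω²(r − rp)(r + rp)`
    have hKsplit := radialK_eq_horizon_add hM haM ω m r
    set A := rp ^ 2 + a ^ 2 with hAdef
    have hApos : 0 < A := by positivity
    have hAσω : A * σ * ω < 0 := by
      have : A * (ω * σ) < 0 := mul_neg_of_pos_of_neg hApos hωσ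
      linarith [show A * σ * ω = A * (ω * σ) by ring]
    have hKω : radialK a ω m r * ω ≤ ω ^ 2 * ((r - rp) * (r + rp)) := by
      have : radialK a ω m r * ω = A * σ * ω + ω ^ 2 * ((r - rp) * (r + rp)) := by
        rw [hKsplit]; ring
      linarith
    -- `ω² rp² ≤ Λ′/(4(1+θ₁))` and `r(r + rp) ≤ (1 + θ₁/8)(2 + θ₁/8) rp²`
    have hω : 4 * (1 + θ₁) * (ω ^ 2 * rp ^ 2) ≤ Λ' := by
      calc 4 * (1 + θ₁) * (ω ^ 2 * rp ^ 2) = (1 + θ₁) * (2 * rp * ω) ^ 2 := by ring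
        _ ≤ Λ' := hmargin
    have hrr : r * (r + rp) ≤ (1 + θ₁ / 8) * (2 + θ₁ / 8) * rp ^ 2 := by
      have h1 : r ≤ (1 + θ₁ / 8) * rp := by linarith
      have h2 : r + rp ≤ (2 + θ₁ / 8) * rp := by linarith
      calc r * (r + rp) ≤ ((1 + θ₁ / 8) * rp) * ((2 + θ₁ / 8) * rp) :=
            mul_le_mul h1 h2 (by positivity) (by positivity)
        _ = (1 + θ₁ / 8) * (2 + θ₁ / 8) * rp ^ 2 := by ring
    have hpoly : (1 + θ₁ / 8) * (2 + θ₁ / 8) ≤ 2 * (1 + θ₁) * (1 - θ₁ / 4) := by nlinarith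
    have hrrp : 0 ≤ r - rp := by linarith
    calc 4 * r * (radialK a ω m r * ω) ≤ 4 * r * (ω ^ 2 * ((r - rp) * (r + rp))) := by gcongr
      _ = 4 * (r - rp) * (ω ^ 2 * (r * (r + rp))) := by ring
      _ ≤ 4 * (r - rp) * (ω ^ 2 * ((1 + θ₁ / 8) * (2 + θ₁ / 8) * rp ^ 2)) := by gcongr
      _ = (r - rp) * ((1 + θ₁ / 8) * (2 + θ₁ / 8)) * (4 * (ω ^ 2 * rp ^ 2)) := by ring
      _ ≤ (r - rp) * (2 * (1 + θ₁) * (1 - θ₁ / 4)) * (4 * (ω ^ 2 * rp ^ 2)) := by gcongr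
      _ = 2 * (r - rp) * (1 - θ₁ / 4) * (4 * (1 + θ₁) * (ω ^ 2 * rp ^ 2)) := by ring
      _ ≤ 2 * (r - rp) * (1 - θ₁ / 4) * Λ' := by
          apply mul_le_mul_of_nonneg_left hω
          have : 0 ≤ 1 - θ₁ / 4 := by linarith
          positivity
      _ = 2 * Λ' * (r - rp) * (1 - θ₁ / 4) := by ring

/-- **The slope bound `F′ ≤ −(θ₁/2)(Λ′ − 172)(r − r₊) − (r₊ − r₋)(Λ′ − 86)`** on `r₊ < r ≤ r₊(1 + θ₁/8)` in
the superradiant BF-stable regime (`0 < θ₁ ≤ 1`, margin, `ωσ < 0`), where `F′` is the derivative of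
`F(s) = (s² + a²)²(ω² − V(s))` from `hasDerivAt_sq_mul_coeff`. [folklore] -/
theorem sq_mul_coeff_deriv_le (ha : |a| < M) {θ₁ : ℝ} (hθ₁ : 0 < θ₁) (hθ₁1 : θ₁ ≤ 1)
    (hmargin : (1 + θ₁) * (2 * rPlus M a * ω) ^ 2 ≤ Λ - 2 * a * m * ω)
    (hωσ : ω * (ω - m * horizonAngularVelocity M a) < 0)
    {r : ℝ} (hr : rPlus M a < r) (hr2 : r ≤ rPlus M a * (1 + θ₁ / 8)) :
    2 * radialK a ω m r * (ω * (2 * r)) - 2 * (r - M) * (Λ - 2 * a * m * ω) -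
        (2 * (r ^ 2 + a ^ 2) * (2 * r) * sepPotential₁ M a r +
          (r ^ 2 + a ^ 2) ^ 2 * (critPoly₁ M a r / (r ^ 2 + a ^ 2) ^ 5)) ≤
      -(θ₁ / 2) * (Λ - 2 * a * m * ω - 172) * (r - rPlus M a) -
        (rPlus M a - rMinus M a) * (Λ - 2 * a * m * ω - 86) := by
  have hM : 0 < M := lt_of_le_of_lt (abs_nonneg a) ha
  have haM : |a| ≤ M := ha.le
  set rp := rPlus M a with hrp
  set Λ' := Λ - 2 * a * m * ω with hΛ'def
  set d := rp - rMinus M a with hd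
  have hrpM : M ≤ rp := M_le_rPlus M a
  have hrp2 : rp ≤ 2 * M := rPlus_le_two_mul_self hM.le a
  have hrp0 : 0 < rp := rPlus_pos hM a
  have hr0 : 0 < r := hrp0.trans hr
  have hMr : M ≤ r := hrpM.trans hr.le
  have hsub : IsSubextremal M a := ha
  have hd0 : 0 < d := sub_pos.2 hsub.rMinus_lt_rPlus
  set A := r ^ 2 + a ^ 2 with hAdef
  have hApos : 0 < A := by positivity
  -- the three pieces
  have hK := four_mul_radialK_mul_le ha hθ₁ hθ₁1 hmargin hωσ hr hr2
  have hΔ0 : 0 ≤ delta M a r := delta_nonneg haM hr.le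
  have hr94 : r ≤ 9 * M / 4 := by
    have : rp * (1 + θ₁ / 8) ≤ (2 * M) * (9 / 8) :=
      mul_le_mul hrp2 (by linarith) (by positivity) (by positivity)
    linarith
  have hP₁ := critPoly₁_ge_neg hM haM hMr hr94 hΔ0
  have hV₁0 : 0 ≤ sepPotential₁ M a r := sepPotential₁_nonneg haM hr.le
  have hA1 : M ^ 2 ≤ A := by
    have : M ^ 2 ≤ r ^ 2 := pow_le_pow_left₀ hM.le hMr 2
    have := sq_nonneg a
    rw [hAdef]; linarith
  have hA3 : M ^ 6 ≤ A ^ 3 := by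
    have := pow_le_pow_left₀ (by positivity) hA1 3
    have e : (M ^ 2) ^ 3 = M ^ 6 := by ring
    rwa [e] at this
  have hcrit : -(344 / M) * delta M a r ≤ critPoly₁ M a r / A ^ 3 := by
    rw [le_div_iff₀ (by positivity)]
    have h2 : -(344 / M) * delta M a r * A ^ 3 ≤ -(344 / M) * delta M a r * M ^ 6 := by
      have hneg : -(344 / M) * delta M a r ≤ 0 := by
        have : 0 ≤ 344 / M * delta M a r := by positivity
        linarith
      exact mul_le_mul_of_nonpos_left hA3 hneg
    have e : -(344 / M) * delta M a r * M ^ 6 = -(344 * M ^ 5) * delta M a r := by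
      field_simp
    linarith
  have hW₁d : -(344 / M) * delta M a r ≤ 2 * (r ^ 2 + a ^ 2) * (2 * r) * sepPotential₁ M a r +
      (r ^ 2 + a ^ 2) ^ 2 * (critPoly₁ M a r / (r ^ 2 + a ^ 2) ^ 5) := by
    have h1 : 0 ≤ 2 * (r ^ 2 + a ^ 2) * (2 * r) * sepPotential₁ M a r := by positivity
    have e : (r ^ 2 + a ^ 2) ^ 2 * (critPoly₁ M a r / (r ^ 2 + a ^ 2) ^ 5) = critPoly₁ M a r / A ^ 3 := by
      rw [hAdef]; field_simp
    rw [e]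
    linarith [hcrit]
  -- `2(r − M) = 2(r − rp) + d` and `(344/M)Δ ≤ 86θ₁(r − rp) + 86 d`
  have hsum : rp + rMinus M a = 2 * M := by rw [hrp]; unfold rPlus rMinus; ring
  have h2rM : 2 * (r - M) = 2 * (r - rp) + d := by rw [hd]; linarith
  have hrrp : 0 ≤ r - rp := by linarith
  have hrrp' : r - rp ≤ θ₁ * M / 4 := by
    have h1 : rp * (θ₁ / 8) ≤ (2 * M) * (θ₁ / 8) := mul_le_mul_of_nonneg_right hrp2 (by positivity)
    have e1 : rp * (1 + θ₁ / 8) = rp + rp * (θ₁ / 8) := by ring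
    linarith
  have hΔle : 344 / M * delta M a r ≤ 86 * θ₁ * (r - rp) + 86 * θ₁ * d := by
    rw [delta_eq_mul haM r, ← hrp]
    have e1 : r - rMinus M a = (r - rp) + d := by rw [hd]; ring
    rw [e1]
    have h1 : 344 / M * (r - rp) ≤ 86 * θ₁ := by
      rw [div_mul_eq_mul_div, div_le_iff₀ hM]; linarith
    calc 344 / M * ((r - rp) * ((r - rp) + d)) = (344 / M * (r - rp)) * ((r - rp) + d) := by ring
      _ ≤ (86 * θ₁) * ((r - rp) + d) := mul_le_mul_of_nonneg_right h1 (by linarith)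
      _ = 86 * θ₁ * (r - rp) + 86 * θ₁ * d := by ring
  have hθd : 86 * θ₁ * d ≤ 86 * d := by
    have := mul_le_mul_of_nonneg_left hθ₁1 (by positivity : (0:ℝ) ≤ 86 * d)
    linarith
  -- assemble (linear in the monomials `Λ′(r − rp)`, `θ₁Λ′(r − rp)`, `dΛ′`, `θ₁(r − rp)`, `d`)
  rw [h2rM]
  linarith [hK, hW₁d, hΔle, hθd]

/-- **Integrated slope bound.** In the same regime, for `r₊ < r_b ≤ r ≤ r₊(1 + θ₁/8)`:
`F(r) ≤ F(r_b) − (θ₁/4)(Λ′ − 172)((r − r₊)² − (r_b − r₊)²) − (r₊ − r₋)(Λ′ − 86)(r − r_b)`,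
`F(s) = (s² + a²)²(ω² − V(s))` (the function `F + (θ₁/4)(Λ′ − 172)(s − r₊)² + (r₊ − r₋)(Λ′ − 86)s` is
non-increasing). [folklore] -/
theorem sq_mul_coeff_le_of_le (ha : |a| < M) {θ₁ : ℝ} (hθ₁ : 0 < θ₁) (hθ₁1 : θ₁ ≤ 1)
    (hmargin : (1 + θ₁) * (2 * rPlus M a * ω) ^ 2 ≤ Λ - 2 * a * m * ω)
    (hωσ : ω * (ω - m * horizonAngularVelocity M a) < 0)
    {rb r : ℝ} (hrb : rPlus M a < rb) (hrbr : rb ≤ r) (hr2 : r ≤ rPlus M a * (1 + θ₁ / 8)) :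
    (r ^ 2 + a ^ 2) ^ 2 * (ω ^ 2 - sepPotential M a ω m Λ r) ≤
      (rb ^ 2 + a ^ 2) ^ 2 * (ω ^ 2 - sepPotential M a ω m Λ rb) -
        θ₁ / 4 * (Λ - 2 * a * m * ω - 172) * ((r - rPlus M a) ^ 2 - (rb - rPlus M a) ^ 2) -
        (rPlus M a - rMinus M a) * (Λ - 2 * a * m * ω - 86) * (r - rb) := by
  have hM : 0 < M := lt_of_le_of_lt (abs_nonneg a) ha
  set rp := rPlus M a with hrp
  set Λ' := Λ - 2 * a * m * ω with hΛ'def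
  set d := rp - rMinus M a with hd
  set c := θ₁ / 4 * (Λ' - 172) with hc
  set e := d * (Λ' - 86) with he
  have hrp0 : 0 < rp := rPlus_pos hM a
  set G : ℝ → ℝ := fun s ↦ (s ^ 2 + a ^ 2) ^ 2 * (ω ^ 2 - sepPotential M a ω m Λ s) +
    c * (s - rp) ^ 2 + e * s with hG
  have hGd : ∀ s ∈ Icc rb r, HasDerivAt G
      ((2 * radialK a ω m s * (ω * (2 * s)) - 2 * (s - M) * Λ' -
        (2 * (s ^ 2 + a ^ 2) * (2 * s) * sepPotential₁ M a s +
          (s ^ 2 + a ^ 2) ^ 2 * (critPoly₁ M a s / (s ^ 2 + a ^ 2) ^ 5))) +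
        c * (2 * (s - rp)) + e) s := by
    intro s hs
    have hs0 : 0 < s := hrp0.trans (hrb.trans_le hs.1)
    have h1 := hasDerivAt_sq_mul_coeff M a ω m Λ hs0
    have h2 : HasDerivAt (fun t : ℝ ↦ c * (t - rp) ^ 2) (c * (2 * (s - rp))) s := by
      have := ((hasDerivAt_id s).sub_const rp).fun_pow 2 |>.const_mul c
      refine this.congr_deriv ?_
      simp
    have h3 : HasDerivAt (fun t : ℝ ↦ e * t) e s := by
      simpa using (hasDerivAt_id s).const_mul e
    exact (h1.add h2).add h3
  have hGle : ∀ s ∈ Icc rb r, (2 * radialK a ω m s * (ω * (2 * s)) - 2 * (s - M) * Λ' -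
        (2 * (s ^ 2 + a ^ 2) * (2 * s) * sepPotential₁ M a s +
          (s ^ 2 + a ^ 2) ^ 2 * (critPoly₁ M a s / (s ^ 2 + a ^ 2) ^ 5))) +
        c * (2 * (s - rp)) + e ≤ 0 := by
    intro s hs
    have hs1 : rp < s := hrb.trans_le hs.1
    have hs2 : s ≤ rp * (1 + θ₁ / 8) := hs.2.trans hr2
    have h := sq_mul_coeff_deriv_le ha hθ₁ hθ₁1 hmargin hωσ hs1 hs2
    have e1 : -(θ₁ / 2) * (Λ' - 172) * (s - rp) - d * (Λ' - 86) + c * (2 * (s - rp)) + e = 0 := by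
      rw [hc, he]; ring
    linarith
  have hanti : AntitoneOn G (Icc rb r) :=
    antitoneOn_of_deriv_nonpos (convex_Icc rb r)
      (fun s hs ↦ (hGd s hs).continuousAt.continuousWithinAt)
      (fun s hs ↦ (hGd s (interior_subset hs)).differentiableAt.differentiableWithinAt)
      fun s hs ↦ by
        have hs' : s ∈ Icc rb r := interior_subset hs
        rw [(hGd s hs').deriv]
        exact hGle s hs'
  have h := hanti (left_mem_Icc.2 hrbr) (right_mem_Icc.2 hrbr) hrbr
  simp only [hG] at h
  have e2 : c * (r - rp) ^ 2 + e * r - (c * (rb - rp) ^ 2 + e * rb) =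
      c * ((r - rp) ^ 2 - (rb - rp) ^ 2) + e * (r - rb) := by ring
  rw [hc, he] at e2
  linarith

/-- **Explicit barrier floor beyond the cap edge.** In the same regime, if `V(r_b) ≥ ω²` at some
`r₊ < r_b` (e.g. the cap edge), then for `r_b ≤ r ≤ r₊(1 + θ₁/8)`:
`[(θ₁/4)(Λ′ − 172)((r − r₊)² − (r_b − r₊)²) + (r₊ − r₋)(Λ′ − 86)(r − r_b)]/(r² + a²)² ≤ V(r) − ω²`
(a positive, at least linearly growing floor once `Λ′ ≥ 172`). [folklore] -/
theorem negCoeff_ge_of_cap_edge (ha : |a| < M) {θ₁ : ℝ} (hθ₁ : 0 < θ₁) (hθ₁1 : θ₁ ≤ 1)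
    (hmargin : (1 + θ₁) * (2 * rPlus M a * ω) ^ 2 ≤ Λ - 2 * a * m * ω)
    (hωσ : ω * (ω - m * horizonAngularVelocity M a) < 0)
    {rb r : ℝ} (hrb : rPlus M a < rb) (hrbr : rb ≤ r) (hr2 : r ≤ rPlus M a * (1 + θ₁ / 8))
    (hVb : ω ^ 2 ≤ sepPotential M a ω m Λ rb) :
    (θ₁ / 4 * (Λ - 2 * a * m * ω - 172) * ((r - rPlus M a) ^ 2 - (rb - rPlus M a) ^ 2) +
        (rPlus M a - rMinus M a) * (Λ - 2 * a * m * ω - 86) * (r - rb)) / (r ^ 2 + a ^ 2) ^ 2 ≤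
      sepPotential M a ω m Λ r - ω ^ 2 := by
  have hM : 0 < M := lt_of_le_of_lt (abs_nonneg a) ha
  have hrp0 : 0 < rPlus M a := rPlus_pos hM a
  have hr0 : 0 < r := hrp0.trans (hrb.trans_le hrbr)
  have hA2 : 0 < (r ^ 2 + a ^ 2) ^ 2 := by positivity
  have h := sq_mul_coeff_le_of_le ha hθ₁ hθ₁1 hmargin hωσ hrb hrbr hr2
  have hFb : (rb ^ 2 + a ^ 2) ^ 2 * (ω ^ 2 - sepPotential M a ω m Λ rb) ≤ 0 :=
    mul_nonpos_of_nonneg_of_nonpos (sq_nonneg _) (by linarith)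
  rw [div_le_iff₀ hA2]
  nlinarith [h, hFb]

end Slope

end Kerr

end Literature.Geometry.Lorentzian

end
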